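import Mathlib
import HarnessLib

/-!
# Barrier (structural, PROVED): the COHERENT-ADMIXTURE FLOOR of energy-window observable brackets —
# «coherent admixtures cost energy ∝ p but move ⟨V⟩ ∝ √p» (the √t law behind LADDER-CHEM §2 door A /
# door U5; the pure-state companion of the Hubbard barrier `EnergyWindowCeilingResolution`)

Barrier record of the venture `Summits/Ventures/CertifiedQuantumChemistry` (LADDER-CHEM D-0105 (1), rung
X1), directory `Barriers/`. Typer chem-type-10 (X1 item (6), second deliverable; chem-lead B6-4
2026-08-26T22:50:26Z: «type it as a theorem about the abstract window functional with the N₂ numbers only in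
the docstring»). Part 1 of 2 (generic finite-dimensional theorem); part 2,
`Barriers/EnergyWindowDifferenceFloor.lean`, links it to the cell's `dE-direct:d` pencil legs.

HONEST FRAMING of the venture (verbatim): certified bounds for a stated model Hamiltonian in a stated
basis; not a claim about the real molecule or material beyond that model. Nothing in this file is a number
about any file; it is a kernel-checked LIMITATION of one certificate class, with its door.

## What is typed (in-house source, as printed)

chem-solver-6, `HOME/solver/diff-lambda/DESIGN.md` §2 (sha16 c727d334b8255af4), (2.2) verbatim: «WHY √t AND
NOT t (the adversary, exact states) [thm-level, two lines]: in an energy window of thickness t above E₀, the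
trial φ = √(1−p)ψ₀ + √p·χ (χ ⊥ ψ₀, ⟨χ,(H−E₀)χ⟩ = t/p) is admissible and moves ⟨V⟩ by
2√(p(1−p))·Re⟨ψ₀,Vχ⟩ + O(p): maximising over χ gives 2√t·‖(H−E₀)^{−½}Q V ψ₀‖ = √(2·t·|E″(0)|) to leading
order — COHERENT admixtures cost energy ∝ p but move ⟨V⟩ ∝ √p. Incoherent mixtures (1−p)ρ₀ + p·ρ_k move
⟨V⟩ only ∝ p = t/(E_k − E₀) (LINEAR in t). Hence the floor is removed exactly by constraints that kill
coherent ground–excited admixtures, i.e. STATIONARITY ⟨[H, X]⟩_Γ = 0»; and the hand-off line (INBOX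
2026-08-26T22:24:22Z): «a two-line finite-dim construction that IS typable as a theorem about the exact
energy window: sup{⟨φ,Vφ⟩ : ‖φ‖=1, ⟨φ,Hφ⟩ ≤ E₀ + t} − ⟨ψ₀,Vψ₀⟩ ≥ 2√t·|⟨ψ₀,Vχ⟩|/√⟨χ,(H−E₀)χ⟩ − t·(…) for
every unit χ ⊥ ψ₀». Print status (chem-lit-1 I-DIFF-PRINT 16:08:49Z / FRESHNESS-CHEM §1.8): the energy-window
observable SDP is printed (Han 2020 eq. (ob); Wang et al., PRX 14 (2024) 031006 eq. (obsopt)); this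
resolution floor for it is NOT in print («null-print»); the incoherent-MIXTURE version is the tree's Hubbard
barrier `Literature.Barriers.HubbardSuperconductivity.EnergyWindowCeilingResolution` (`window_ceiling_ge`:
dilution LINEAR in `G/D`) — cited, not restated; the present file is its pure-state √-companion.

## The theorem (finite dimension; vectors `v : n → ℂ`, `⟨x, y⟩ = star x ⬝ᵥ y`, operators `Matrix n n ℂ`)

Data: a Hermitian `H`, a unit vector `ψ` with `H ψ = E₀ ψ`, a unit vector `χ` orthogonal to `ψ` with
EXCITATION `g := Re⟨χ, Hχ⟩ − E₀`, any matrix `V` (Hermitian where stated), a mixing weight `p ∈ [0, 1]`.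
* §1 `admix a b ψ χ = a·ψ + b·χ` (real `a, b`): norm `a² + b²` (`admix_norm`), quadratic form
  `a²⟨ψ,Xψ⟩ + b²⟨χ,Xχ⟩ + ab(⟨ψ,Xχ⟩ + ⟨χ,Xψ⟩)` (`admix_form`), real part for Hermitian `X`
  (`re_admix_form`), ENERGY `Re⟨φ,Hφ⟩ = a²E₀ + b²·Re⟨χ,Hχ⟩` — the cross term vanishes on an eigenvector
  (`re_admix_energy`); a PHASE `ω`, `‖ω‖ = 1`, aligning `ω·⟨ψ,Vχ⟩ = |⟨ψ,Vχ⟩|` (`exists_phase_align`).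
* §2 **`exists_coherent_pair`**: for `p ∈ [0,1]` there are `φ₊, φ₋ ∈ span{ψ, χ}`, both UNIT, both of energy
  EXACTLY `E₀ + p·g`, with `Re⟨φ₊,Vφ₊⟩ − Re⟨φ₋,Vφ₋⟩ = 4·√(p(1−p))·|⟨ψ,Vχ⟩|` and
  `Re⟨φ±,Vφ±⟩ = (1−p)·Re⟨ψ,Vψ⟩ + p·Re⟨χ,Vχ⟩ ± 2·√(p(1−p))·|⟨ψ,Vχ⟩|`.
* §3 the WINDOW FUNCTIONAL. `IsWindowBracket H K E V lo hi`: `lo ≤ Re⟨φ,Vφ⟩ ≤ hi` for every unit `φ` of the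
  submodule `K` (a symmetry sector) with `Re⟨φ,Hφ⟩ ≤ E`. **`windowBracket_width_ge`**: for `ψ, χ ∈ K` as above,
  `0 < g`, `0 ≤ t ≤ g`: `hi − lo ≥ 4·√((t/g)(1 − t/g))·|⟨ψ,Vχ⟩|`; **`windowBracket_width_ge_sqrt`**: for
  `t ≤ g/2`, `hi − lo ≥ 2·√2·√(t/g)·|⟨ψ,Vχ⟩|` — the √t law; one-sided forms with the linear correction
  `p·(Re⟨ψ,Vψ⟩ − Re⟨χ,Vχ⟩)` (`windowBracket_hi_ge`, `windowBracket_lo_le`), the hand-off's «− t·(…)».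
* §4 the barrier as a `Prop`, `Barriers.EnergyWindowCoherentAdmixtureFloor`, with its proof.

Reading (numbers are chem-solver-6's / chem-solver-4's, NOT this file's; [est] unless marked): with the
window thickness `t` replaced by the CERTIFIED absolute thickness `U − L` of a relaxation (the heuristic
transfer of §2.1: every exact state of energy `≤ U` is relaxation-feasible), and `χ` the optimal response
direction, the floor reads `W ≳ 2√(2·t·(c_A + c_B))` for a `dE-direct:d`/`:b` difference bracket
(`c_A = ⟨H_B⟩_{ψ_A} − E_B`), «beats dE-from-absolutes iff c_A + c_B ≲ t/2, θ-informative iff t·(c_A + c_B) ≲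
θ²/8»; N₂/STO-6G near pair `t̄ ≈ 15`, `c_A + c_B = 8.65` ⇒ `W ≳ 32 mE_h` predicted vs 36 measured [cert-P:
chem-solver-4 kit j257770/j258422, chem-solver-6 kit j260074 — 56 + 63 legs, all within the law]. DOOR (the evasion, (2.2) last sentence): rows violated by coherent ground–excited admixtures —
STATIONARITY `⟨[H, X]⟩ = 0` (for an eigenvector `χ`, `H χ = E₁ χ`, the admixture has
`⟨φ,[H,X]φ⟩ = ab(E₀ − E₁)(⟨ψ,Xχ⟩ − ⟨χ,Xψ⟩)`, non-zero iff `Im⟨ψ,Xχ'⟩ ≠ 0`), available at the 2-RDM level only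
for ONE-BODY `X` (Brillouin rows; (2.3): −1.7 % of the floor on the N₂ pair) — and certificates that are not
window functionals at all (Temple-β, door M1; moments, door M4). General form of the additivity side of the
same barrier («any shared / Schur-complemented / downfolded pair of dual certificates brackets the difference
with width ≥ W_A* + W_B*», chem-idea-2 DESIGN-M3 v0 b0525ed5b2f3a66f thm A + identity B) — see
`Barriers/DifferencePencilCeiling*.lean` (p475418/p475601/p475660), of which thm A is the class-independent
wording.

References: Mathlib only; tree (cited, not imported): the Hubbard barrier `EnergyWindowCeilingResolution`
(mixture form, Wang et al. 2024 §II.D) and `EnergyBracketBlindToObservables` (the `t → gap` endpoint).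
-/

noncomputable section

namespace Summit.Ventures.CertifiedQuantumChemistry

open Matrix
open scoped ComplexOrder

variable {n : Type*} [Fintype n]

/-! ## §1 Coherent admixtures of two orthonormal vectors -/

/-- The COHERENT ADMIXTURE `a·ψ + b·χ` with real amplitudes (the adversary's trial vector
`√(1−p)·ψ₀ + √p·χ` of DESIGN.md (2.2)). -/
def admix (a b : ℝ) (ψ χ : n → ℂ) : n → ℂ := ((a : ℝ) : ℂ) • ψ + ((b : ℝ) : ℂ) • χ

omit [Fintype n] in
/-- An admixture of two vectors of a submodule (symmetry sector) stays in it. -/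
theorem admix_mem {K : Submodule ℂ (n → ℂ)} (a b : ℝ) {ψ χ : n → ℂ} (hψ : ψ ∈ K) (hχ : χ ∈ K) :
    admix a b ψ χ ∈ K :=
  K.add_mem (K.smul_mem _ hψ) (K.smul_mem _ hχ)

/-- Hermitian symmetry of a sesquilinear expectation: `conj ⟨x, A y⟩ = ⟨y, A x⟩` for `Aᴴ = A` (local copy of
the tree's `Rows/FrozenCoreRelaxationParticleHole.star_dotProduct_mulVec_of_isHermitian`, kept private). -/
private theorem star_expect_swap {A : Matrix n n ℂ} (hA : A.IsHermitian) (x y : n → ℂ) :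
    star (star x ⬝ᵥ A *ᵥ y) = star y ⬝ᵥ A *ᵥ x := by
  rw [star_dotProduct, star_star, star_mulVec, hA.eq, ← dotProduct_mulVec]

/-- `conj ⟨x, y⟩ = ⟨y, x⟩`. -/
private theorem star_dotProduct_swap (x y : n → ℂ) : star (star x ⬝ᵥ y) = star y ⬝ᵥ x := by
  rw [star_dotProduct, star_star]
/-- The quadratic form of ANY matrix on an admixture:
`⟨aψ + bχ, X(aψ + bχ)⟩ = a²⟨ψ,Xψ⟩ + b²⟨χ,Xχ⟩ + ab·(⟨ψ,Xχ⟩ + ⟨χ,Xψ⟩)`. -/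
theorem admix_form (a b : ℝ) (ψ χ : n → ℂ) (X : Matrix n n ℂ) :
    star (admix a b ψ χ) ⬝ᵥ X *ᵥ admix a b ψ χ =
      (a : ℂ) ^ 2 * (star ψ ⬝ᵥ X *ᵥ ψ) + (b : ℂ) ^ 2 * (star χ ⬝ᵥ X *ᵥ χ) +
        (a : ℂ) * (b : ℂ) * (star ψ ⬝ᵥ X *ᵥ χ + star χ ⬝ᵥ X *ᵥ ψ) := by
  simp only [admix, star_add, star_smul, Complex.star_def, Complex.conj_ofReal, mulVec_add,
    mulVec_smul, add_dotProduct, dotProduct_add, smul_dotProduct, dotProduct_smul, smul_eq_mul]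
  ring_nf

/-- NORM of an admixture of two ORTHONORMAL vectors: `‖aψ + bχ‖² = a² + b²`. -/
theorem admix_norm (a b : ℝ) {ψ χ : n → ℂ} (hψ : star ψ ⬝ᵥ ψ = 1) (hχ : star χ ⬝ᵥ χ = 1)
    (horth : star ψ ⬝ᵥ χ = 0) :
    star (admix a b ψ χ) ⬝ᵥ admix a b ψ χ = (((a ^ 2 + b ^ 2 : ℝ)) : ℂ) := by
  have horth' : star χ ⬝ᵥ ψ = 0 := by rw [← star_dotProduct_swap, horth, star_zero]
  simp only [admix, star_add, star_smul, Complex.star_def, Complex.conj_ofReal, add_dotProduct,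
    dotProduct_add, smul_dotProduct, dotProduct_smul, smul_eq_mul, hψ, hχ, horth, horth']
  push_cast
  ring

/-- REAL PART of the quadratic form of a HERMITIAN matrix on an admixture:
`Re⟨aψ + bχ, X(aψ + bχ)⟩ = a²·Re⟨ψ,Xψ⟩ + b²·Re⟨χ,Xχ⟩ + 2ab·Re⟨ψ,Xχ⟩`. -/
theorem re_admix_form (a b : ℝ) (ψ χ : n → ℂ) {X : Matrix n n ℂ} (hX : X.IsHermitian) :
    (star (admix a b ψ χ) ⬝ᵥ X *ᵥ admix a b ψ χ).re =
      a ^ 2 * (star ψ ⬝ᵥ X *ᵥ ψ).re + b ^ 2 * (star χ ⬝ᵥ X *ᵥ χ).re +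
        2 * a * b * (star ψ ⬝ᵥ X *ᵥ χ).re := by
  have hsym : star χ ⬝ᵥ X *ᵥ ψ = star (star ψ ⬝ᵥ X *ᵥ χ) :=
    (star_expect_swap hX ψ χ).symm
  rw [admix_form, hsym]
  simp only [Complex.add_re, Complex.add_im, Complex.mul_re, Complex.mul_im, Complex.star_def,
    Complex.conj_re, Complex.conj_im, ← Complex.ofReal_pow, Complex.ofReal_re, Complex.ofReal_im,
    zero_mul, mul_zero, sub_zero, add_zero]
  ring

/-- ENERGY of an admixture of the ground eigenvector `ψ` (`Hψ = E₀ψ`) with an orthogonal unit `χ`: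
the cross term vanishes, `Re⟨aψ + bχ, H(aψ + bχ)⟩ = a²·E₀ + b²·Re⟨χ,Hχ⟩` — «coherent admixtures cost
energy ∝ p» (`p = b²`). -/
theorem re_admix_energy (a b : ℝ) {ψ χ : n → ℂ} {H : Matrix n n ℂ} (hH : H.IsHermitian) {E₀ : ℝ}
    (hHψ : H *ᵥ ψ = (E₀ : ℂ) • ψ) (hψ : star ψ ⬝ᵥ ψ = 1) (horth : star ψ ⬝ᵥ χ = 0) :
    (star (admix a b ψ χ) ⬝ᵥ H *ᵥ admix a b ψ χ).re = a ^ 2 * E₀ + b ^ 2 * (star χ ⬝ᵥ H *ᵥ χ).re := by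
  have horth' : star χ ⬝ᵥ ψ = 0 := by rw [← star_dotProduct_swap, horth, star_zero]
  have h1 : star ψ ⬝ᵥ H *ᵥ ψ = (E₀ : ℂ) := by rw [hHψ, dotProduct_smul, hψ, smul_eq_mul, mul_one]
  have h2 : star χ ⬝ᵥ H *ᵥ ψ = 0 := by rw [hHψ, dotProduct_smul, horth', smul_zero]
  have h3 : star ψ ⬝ᵥ H *ᵥ χ = 0 := by
    rw [← star_expect_swap hH χ ψ, h2, star_zero]
  rw [admix_form, h1, h2, h3, add_zero, mul_zero, add_zero]
  simp only [Complex.add_re, Complex.mul_re, ← Complex.ofReal_pow, Complex.ofReal_re, Complex.ofReal_im,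
    zero_mul, sub_zero]

/-- PHASE ALIGNMENT: every complex number `z` has a unimodular `ω` with `ω·z = |z|`. -/
theorem exists_phase_align (z : ℂ) : ∃ ω : ℂ, ‖ω‖ = 1 ∧ ω * z = (‖z‖ : ℂ) := by
  by_cases hz : z = 0
  · exact ⟨1, by simp, by simp [hz]⟩
  · have hn : (‖z‖ : ℂ) ≠ 0 := by exact_mod_cast (norm_ne_zero_iff.2 hz)
    refine ⟨(starRingEnd ℂ) z / (‖z‖ : ℂ), ?_, ?_⟩
    · rw [norm_div, Complex.norm_conj, Complex.norm_real, Real.norm_eq_abs, abs_norm,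
        div_self (norm_ne_zero_iff.2 hz)]
    · rw [div_mul_eq_mul_div, ← Complex.normSq_eq_conj_mul_self, Complex.normSq_eq_norm_sq]
      push_cast
      rw [pow_two, mul_div_assoc, div_self hn, mul_one]

/-- A unimodular phase keeps a unit vector unit: `‖ω·χ‖² = ‖χ‖²`. -/
theorem phase_norm {ω : ℂ} (hω : ‖ω‖ = 1) (χ : n → ℂ) :
    star (ω • χ) ⬝ᵥ (ω • χ) = star χ ⬝ᵥ χ := by
  rw [star_smul, smul_dotProduct, dotProduct_smul, smul_smul, Complex.star_def,
    ← Complex.normSq_eq_conj_mul_self, Complex.normSq_eq_norm_sq, hω, one_pow, Complex.ofReal_one,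
    one_smul]

/-- A phase keeps expectations: `⟨ω·χ, X(ω·χ)⟩ = ⟨χ, Xχ⟩` for `‖ω‖ = 1`. -/
theorem phase_form {ω : ℂ} (hω : ‖ω‖ = 1) (χ : n → ℂ) (X : Matrix n n ℂ) :
    star (ω • χ) ⬝ᵥ X *ᵥ (ω • χ) = star χ ⬝ᵥ X *ᵥ χ := by
  rw [star_smul, smul_dotProduct, mulVec_smul, dotProduct_smul, smul_smul, Complex.star_def,
    ← Complex.normSq_eq_conj_mul_self, Complex.normSq_eq_norm_sq, hω, one_pow, Complex.ofReal_one,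
    one_smul]

/-- A phase keeps orthogonality to `ψ`: `⟨ψ, ω·χ⟩ = ω·⟨ψ, χ⟩`. -/
theorem dotProduct_phase (ω : ℂ) (ψ χ : n → ℂ) : star ψ ⬝ᵥ (ω • χ) = ω * (star ψ ⬝ᵥ χ) := by
  rw [dotProduct_smul, smul_eq_mul]

/-- The transition element acquires the phase: `⟨ψ, X(ω·χ)⟩ = ω·⟨ψ, Xχ⟩`. -/
theorem dotProduct_mulVec_phase (ω : ℂ) (ψ χ : n → ℂ) (X : Matrix n n ℂ) :
    star ψ ⬝ᵥ X *ᵥ (ω • χ) = ω * (star ψ ⬝ᵥ X *ᵥ χ) := by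
  rw [mulVec_smul, dotProduct_smul, smul_eq_mul]

/-! ## §2 The adversary pair `φ± = √(1−p)·ψ ± √p·ωχ` -/

/-- **THE COHERENT-ADMIXTURE ADVERSARY (DESIGN.md (2.2)).** Let `H` be Hermitian with unit ground
eigenvector `ψ` (`Hψ = E₀ψ`), `χ` a unit vector orthogonal to `ψ`, `V` Hermitian and `p ∈ [0, 1]`. Then there
are two UNIT vectors `φ₊, φ₋` in `span{ψ, χ}`, both of energy EXACTLY `E₀ + p·(Re⟨χ,Hχ⟩ − E₀)` («cost energy
∝ p»), whose `V`-expectations are `(1−p)·Re⟨ψ,Vψ⟩ + p·Re⟨χ,Vχ⟩ ± 2√(p(1−p))·|⟨ψ,Vχ⟩|` («move ⟨V⟩ ∝ √p»);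
in particular they differ by `4·√(p(1−p))·|⟨ψ,Vχ⟩|`. (`φ± = √(1−p)·ψ ± √p·ω·χ` with the phase `ω` aligning
`ω⟨ψ,Vχ⟩ = |⟨ψ,Vχ⟩|`.) -/
theorem exists_coherent_pair {H V : Matrix n n ℂ} (hH : H.IsHermitian) (hV : V.IsHermitian) {E₀ : ℝ}
    {ψ χ : n → ℂ} (hHψ : H *ᵥ ψ = (E₀ : ℂ) • ψ) (hψ : star ψ ⬝ᵥ ψ = 1) (hχ : star χ ⬝ᵥ χ = 1)
    (horth : star ψ ⬝ᵥ χ = 0) {p : ℝ} (hp0 : 0 ≤ p) (hp1 : p ≤ 1) :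
    ∃ φp φm : n → ℂ,
      φp ∈ Submodule.span ℂ {ψ, χ} ∧ φm ∈ Submodule.span ℂ {ψ, χ} ∧
      star φp ⬝ᵥ φp = 1 ∧ star φm ⬝ᵥ φm = 1 ∧
      (star φp ⬝ᵥ H *ᵥ φp).re = E₀ + p * ((star χ ⬝ᵥ H *ᵥ χ).re - E₀) ∧
      (star φm ⬝ᵥ H *ᵥ φm).re = E₀ + p * ((star χ ⬝ᵥ H *ᵥ χ).re - E₀) ∧
      (star φp ⬝ᵥ V *ᵥ φp).re = (1 - p) * (star ψ ⬝ᵥ V *ᵥ ψ).re + p * (star χ ⬝ᵥ V *ᵥ χ).re +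
          2 * Real.sqrt (p * (1 - p)) * ‖star ψ ⬝ᵥ V *ᵥ χ‖ ∧
      (star φm ⬝ᵥ V *ᵥ φm).re = (1 - p) * (star ψ ⬝ᵥ V *ᵥ ψ).re + p * (star χ ⬝ᵥ V *ᵥ χ).re -
          2 * Real.sqrt (p * (1 - p)) * ‖star ψ ⬝ᵥ V *ᵥ χ‖ := by
  -- phase-align χ
  obtain ⟨ω, hω, hωz⟩ := exists_phase_align (star ψ ⬝ᵥ V *ᵥ χ)
  set χ' : n → ℂ := ω • χ with hχ'def
  have hχ' : star χ' ⬝ᵥ χ' = 1 := by rw [hχ'def, phase_norm hω, hχ]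
  have horth' : star ψ ⬝ᵥ χ' = 0 := by rw [hχ'def, dotProduct_phase, horth, mul_zero]
  have hHχ' : (star χ' ⬝ᵥ H *ᵥ χ').re = (star χ ⬝ᵥ H *ᵥ χ).re := by rw [hχ'def, phase_form hω]
  have hVχ' : (star χ' ⬝ᵥ V *ᵥ χ').re = (star χ ⬝ᵥ V *ᵥ χ).re := by rw [hχ'def, phase_form hω]
  have hVψχ' : (star ψ ⬝ᵥ V *ᵥ χ').re = ‖star ψ ⬝ᵥ V *ᵥ χ‖ := by
    rw [hχ'def, dotProduct_mulVec_phase, hωz, Complex.ofReal_re]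
  have hmemχ' : χ' ∈ Submodule.span ℂ ({ψ, χ} : Set (n → ℂ)) :=
    Submodule.smul_mem _ _ (Submodule.subset_span (by simp))
  have hmemψ : ψ ∈ Submodule.span ℂ ({ψ, χ} : Set (n → ℂ)) := Submodule.subset_span (by simp)
  -- amplitudes
  set a := Real.sqrt (1 - p) with ha
  set b := Real.sqrt p with hb
  have ha2 : a ^ 2 = 1 - p := by rw [ha, Real.sq_sqrt (sub_nonneg.2 hp1)]
  have hb2 : b ^ 2 = p := by rw [hb, Real.sq_sqrt hp0]
  have hab : a * b = Real.sqrt (p * (1 - p)) := by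
    rw [ha, hb, ← Real.sqrt_mul (sub_nonneg.2 hp1), mul_comm]
  refine ⟨admix a b ψ χ', admix a (-b) ψ χ', admix_mem a b hmemψ hmemχ',
    admix_mem a (-b) hmemψ hmemχ', ?_, ?_, ?_, ?_, ?_, ?_⟩
  · rw [admix_norm a b hψ hχ' horth', ha2, hb2]; push_cast; ring
  · rw [admix_norm a (-b) hψ hχ' horth', neg_sq, ha2, hb2]; push_cast; ring
  · rw [re_admix_energy a b hH hHψ hψ horth', hHχ', ha2, hb2]; ring
  · rw [re_admix_energy a (-b) hH hHψ hψ horth', neg_sq, hHχ', ha2, hb2]; ring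
  · rw [re_admix_form a b ψ χ' hV, hVχ', hVψχ', ha2, hb2, mul_assoc 2 a b, hab]
  · rw [re_admix_form a (-b) ψ χ' hV, hVχ', hVψχ', neg_sq, ha2, hb2, mul_neg, mul_assoc 2 a b, hab,
      neg_mul, ← sub_eq_add_neg]

/-! ## §3 The window functional and its resolution floor -/

/-- **A WINDOW BRACKET on `⟨V⟩`**: `lo ≤ Re⟨φ,Vφ⟩ ≤ hi` for EVERY unit vector `φ` of the subspace `K`
(a symmetry sector; `⊤` for none) in the ENERGY WINDOW `Re⟨φ,Hφ⟩ ≤ E`. This is what an energy-window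
observable SDP certifies (Han 2020 (ob); Wang et al. 2024 (obsopt)) — its feasible set contains every such
`φ`, so its optimal values are such a pair — and, by part 2, what the cell's `dE-direct:d` legs certify for
`V = H_A − H_B`. -/
def IsWindowBracket (H : Matrix n n ℂ) (K : Submodule ℂ (n → ℂ)) (E : ℝ) (V : Matrix n n ℂ)
    (lo hi : ℝ) : Prop :=
  ∀ φ : n → ℂ, φ ∈ K → star φ ⬝ᵥ φ = 1 → (star φ ⬝ᵥ H *ᵥ φ).re ≤ E →
    lo ≤ (star φ ⬝ᵥ V *ᵥ φ).re ∧ (star φ ⬝ᵥ V *ᵥ φ).re ≤ hi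

/-- **THE COHERENT-ADMIXTURE FLOOR (two-sided, exact).** For a Hermitian `H`, a unit ground eigenvector
`ψ ∈ K` (`Hψ = E₀ψ`), a unit `χ ∈ K` orthogonal to `ψ` with excitation `g = Re⟨χ,Hχ⟩ − E₀ > 0`, a Hermitian
`V`, and a window of thickness `0 ≤ t ≤ g` above `E₀`: EVERY window bracket `[lo, hi]` on `⟨V⟩` has
`hi − lo ≥ 4·√((t/g)·(1 − t/g))·|⟨ψ,Vχ⟩|`. (Both adversary vectors of `exists_coherent_pair` with
`p = t/g` lie in the window.) -/
theorem windowBracket_width_ge {H V : Matrix n n ℂ} (hH : H.IsHermitian) (hV : V.IsHermitian)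
    {K : Submodule ℂ (n → ℂ)} {E₀ : ℝ} {ψ χ : n → ℂ} (hψK : ψ ∈ K) (hχK : χ ∈ K)
    (hHψ : H *ᵥ ψ = (E₀ : ℂ) • ψ) (hψ : star ψ ⬝ᵥ ψ = 1) (hχ : star χ ⬝ᵥ χ = 1)
    (horth : star ψ ⬝ᵥ χ = 0) {t : ℝ} (ht0 : 0 ≤ t)
    (htg : t ≤ (star χ ⬝ᵥ H *ᵥ χ).re - E₀) (hg : 0 < (star χ ⬝ᵥ H *ᵥ χ).re - E₀)
    {lo hi : ℝ} (hW : IsWindowBracket H K (E₀ + t) V lo hi) :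
    4 * Real.sqrt (t / ((star χ ⬝ᵥ H *ᵥ χ).re - E₀) * (1 - t / ((star χ ⬝ᵥ H *ᵥ χ).re - E₀))) *
        ‖star ψ ⬝ᵥ V *ᵥ χ‖ ≤ hi - lo := by
  set g := (star χ ⬝ᵥ H *ᵥ χ).re - E₀ with hgdef
  have hp0 : 0 ≤ t / g := div_nonneg ht0 hg.le
  have hp1 : t / g ≤ 1 := (div_le_one hg).2 htg
  have hspan : Submodule.span ℂ ({ψ, χ} : Set (n → ℂ)) ≤ K :=
    Submodule.span_le.2 (by
      intro x hx
      simp only [Set.mem_insert_iff, Set.mem_singleton_iff] at hx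
      rcases hx with rfl | rfl <;> assumption)
  obtain ⟨φp, φm, hpK, hmK, hp1n, hm1n, hpE, hmE, hpV, hmV⟩ :=
    exists_coherent_pair hH hV hHψ hψ hχ horth hp0 hp1
  have hEwin : E₀ + t / g * g = E₀ + t := by rw [div_mul_cancel₀ t hg.ne']
  have h1 := (hW φp (hspan hpK) hp1n (by rw [hpE, ← hgdef, hEwin])).2
  have h2 := (hW φm (hspan hmK) hm1n (by rw [hmE, ← hgdef, hEwin])).1
  rw [hpV] at h1
  rw [hmV] at h2
  linarith

/-- **THE √t LAW.** In the regime `t ≤ g/2` (window thinner than half the excitation energy of `χ`):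
`hi − lo ≥ 2·√2·√(t/g)·|⟨ψ,Vχ⟩|` — a window of thickness `t` resolves `⟨V⟩` no better than
`const·√t`, whereas incoherent mixtures would only force `const·t` (Hubbard barrier
`EnergyWindowCeilingResolution.window_ceiling_ge`). -/
theorem windowBracket_width_ge_sqrt {H V : Matrix n n ℂ} (hH : H.IsHermitian) (hV : V.IsHermitian)
    {K : Submodule ℂ (n → ℂ)} {E₀ : ℝ} {ψ χ : n → ℂ} (hψK : ψ ∈ K) (hχK : χ ∈ K)
    (hHψ : H *ᵥ ψ = (E₀ : ℂ) • ψ) (hψ : star ψ ⬝ᵥ ψ = 1) (hχ : star χ ⬝ᵥ χ = 1)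
    (horth : star ψ ⬝ᵥ χ = 0) {t : ℝ} (ht0 : 0 ≤ t)
    (ht2 : 2 * t ≤ (star χ ⬝ᵥ H *ᵥ χ).re - E₀) (hg : 0 < (star χ ⬝ᵥ H *ᵥ χ).re - E₀) {lo hi : ℝ}
    (hW : IsWindowBracket H K (E₀ + t) V lo hi) :
    2 * Real.sqrt 2 * Real.sqrt (t / ((star χ ⬝ᵥ H *ᵥ χ).re - E₀)) * ‖star ψ ⬝ᵥ V *ᵥ χ‖ ≤
      hi - lo := by
  set g := (star χ ⬝ᵥ H *ᵥ χ).re - E₀ with hgdef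
  have htg : t ≤ g := by linarith
  have h := windowBracket_width_ge hH hV hψK hχK hHψ hψ hχ horth ht0 htg hg hW
  -- 2√2·√p ≤ 4·√p·√(1−p) when p ≤ 1/2
  have hp0 : 0 ≤ t / g := div_nonneg ht0 hg.le
  have hphalf : t / g ≤ 1 / 2 := by
    rw [div_le_iff₀ hg]; linarith
  have hhalf : 1 / 2 ≤ 1 - t / g := by linarith
  have hkey : 2 * Real.sqrt 2 * Real.sqrt (t / g) ≤ 4 * Real.sqrt (t / g * (1 - t / g)) := by
    rw [Real.sqrt_mul hp0]
    have hs : Real.sqrt (1 / 2) ≤ Real.sqrt (1 - t / g) := Real.sqrt_le_sqrt hhalf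
    have h22 : Real.sqrt 2 * Real.sqrt (1 / 2) = 1 := by
      rw [← Real.sqrt_mul (by norm_num : (0:ℝ) ≤ 2)]; norm_num
    have h2 : Real.sqrt 2 * Real.sqrt 2 = 2 := Real.mul_self_sqrt (by norm_num)
    have hsq0 : 0 ≤ Real.sqrt (t / g) := Real.sqrt_nonneg _
    calc 2 * Real.sqrt 2 * Real.sqrt (t / g)
        = 2 * Real.sqrt 2 * Real.sqrt (t / g) * (Real.sqrt 2 * Real.sqrt (1 / 2)) := by
          rw [h22, mul_one]
      _ = 2 * (Real.sqrt 2 * Real.sqrt 2) * (Real.sqrt (t / g) * Real.sqrt (1 / 2)) := by ring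
      _ = 4 * (Real.sqrt (t / g) * Real.sqrt (1 / 2)) := by rw [h2]; ring
      _ ≤ 4 * (Real.sqrt (t / g) * Real.sqrt (1 - t / g)) :=
          mul_le_mul_of_nonneg_left (mul_le_mul_of_nonneg_left hs hsq0) (by norm_num)
  exact le_trans (mul_le_mul_of_nonneg_right hkey (norm_nonneg _)) h

/-- **ONE-SIDED FORM, upper end** (the hand-off's `sup − ⟨ψ₀,Vψ₀⟩ ≥ 2√t·|⟨ψ₀,Vχ⟩|/√g − t·(…)`): for
`p = t/g`, `hi ≥ Re⟨ψ,Vψ⟩ + 2·√(p(1−p))·|⟨ψ,Vχ⟩| − p·(Re⟨ψ,Vψ⟩ − Re⟨χ,Vχ⟩)`. -/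
theorem windowBracket_hi_ge {H V : Matrix n n ℂ} (hH : H.IsHermitian) (hV : V.IsHermitian)
    {K : Submodule ℂ (n → ℂ)} {E₀ : ℝ} {ψ χ : n → ℂ} (hψK : ψ ∈ K) (hχK : χ ∈ K)
    (hHψ : H *ᵥ ψ = (E₀ : ℂ) • ψ) (hψ : star ψ ⬝ᵥ ψ = 1) (hχ : star χ ⬝ᵥ χ = 1)
    (horth : star ψ ⬝ᵥ χ = 0) {t : ℝ} (ht0 : 0 ≤ t)
    (htg : t ≤ (star χ ⬝ᵥ H *ᵥ χ).re - E₀) (hg : 0 < (star χ ⬝ᵥ H *ᵥ χ).re - E₀)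
    {lo hi : ℝ} (hW : IsWindowBracket H K (E₀ + t) V lo hi) :
    (star ψ ⬝ᵥ V *ᵥ ψ).re +
        2 * Real.sqrt (t / ((star χ ⬝ᵥ H *ᵥ χ).re - E₀) * (1 - t / ((star χ ⬝ᵥ H *ᵥ χ).re - E₀))) *
          ‖star ψ ⬝ᵥ V *ᵥ χ‖ -
        t / ((star χ ⬝ᵥ H *ᵥ χ).re - E₀) * ((star ψ ⬝ᵥ V *ᵥ ψ).re - (star χ ⬝ᵥ V *ᵥ χ).re) ≤ hi := by
  set g := (star χ ⬝ᵥ H *ᵥ χ).re - E₀ with hgdef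
  have hp0 : 0 ≤ t / g := div_nonneg ht0 hg.le
  have hp1 : t / g ≤ 1 := (div_le_one hg).2 htg
  have hspan : Submodule.span ℂ ({ψ, χ} : Set (n → ℂ)) ≤ K :=
    Submodule.span_le.2 (by
      intro x hx
      simp only [Set.mem_insert_iff, Set.mem_singleton_iff] at hx
      rcases hx with rfl | rfl <;> assumption)
  obtain ⟨φp, φm, hpK, -, hp1n, -, hpE, -, hpV, -⟩ :=
    exists_coherent_pair hH hV hHψ hψ hχ horth hp0 hp1
  have hEwin : E₀ + t / g * g = E₀ + t := by rw [div_mul_cancel₀ t hg.ne']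
  have h1 := (hW φp (hspan hpK) hp1n (by rw [hpE, ← hgdef, hEwin])).2
  rw [hpV] at h1
  linarith

/-- **ONE-SIDED FORM, lower end**: `lo ≤ Re⟨ψ,Vψ⟩ − 2·√(p(1−p))·|⟨ψ,Vχ⟩| − p·(Re⟨ψ,Vψ⟩ − Re⟨χ,Vχ⟩)`. -/
theorem windowBracket_lo_le {H V : Matrix n n ℂ} (hH : H.IsHermitian) (hV : V.IsHermitian)
    {K : Submodule ℂ (n → ℂ)} {E₀ : ℝ} {ψ χ : n → ℂ} (hψK : ψ ∈ K) (hχK : χ ∈ K)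
    (hHψ : H *ᵥ ψ = (E₀ : ℂ) • ψ) (hψ : star ψ ⬝ᵥ ψ = 1) (hχ : star χ ⬝ᵥ χ = 1)
    (horth : star ψ ⬝ᵥ χ = 0) {t : ℝ} (ht0 : 0 ≤ t)
    (htg : t ≤ (star χ ⬝ᵥ H *ᵥ χ).re - E₀) (hg : 0 < (star χ ⬝ᵥ H *ᵥ χ).re - E₀)
    {lo hi : ℝ} (hW : IsWindowBracket H K (E₀ + t) V lo hi) :
    lo ≤ (star ψ ⬝ᵥ V *ᵥ ψ).re -
        2 * Real.sqrt (t / ((star χ ⬝ᵥ H *ᵥ χ).re - E₀) * (1 - t / ((star χ ⬝ᵥ H *ᵥ χ).re - E₀))) *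
          ‖star ψ ⬝ᵥ V *ᵥ χ‖ -
        t / ((star χ ⬝ᵥ H *ᵥ χ).re - E₀) * ((star ψ ⬝ᵥ V *ᵥ ψ).re - (star χ ⬝ᵥ V *ᵥ χ).re) := by
  set g := (star χ ⬝ᵥ H *ᵥ χ).re - E₀ with hgdef
  have hp0 : 0 ≤ t / g := div_nonneg ht0 hg.le
  have hp1 : t / g ≤ 1 := (div_le_one hg).2 htg
  have hspan : Submodule.span ℂ ({ψ, χ} : Set (n → ℂ)) ≤ K :=
    Submodule.span_le.2 (by
      intro x hx
      simp only [Set.mem_insert_iff, Set.mem_singleton_iff] at hx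
      rcases hx with rfl | rfl <;> assumption)
  obtain ⟨φp, φm, -, hmK, -, hm1n, -, hmE, -, hmV⟩ :=
    exists_coherent_pair hH hV hHψ hψ hχ horth hp0 hp1
  have hEwin : E₀ + t / g * g = E₀ + t := by rw [div_mul_cancel₀ t hg.ne']
  have h2 := (hW φm (hspan hmK) hm1n (by rw [hmE, ← hgdef, hEwin])).1
  rw [hmV] at h2
  linarith

/-! ## §4 The barrier as a `Prop` -/
namespace Barriers

/-- **BARRIER «COHERENT-ADMIXTURE FLOOR OF ENERGY-WINDOW OBSERVABLE BRACKETS»** (chem-solver-6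
DESIGN.md (2.2) «coherent admixtures cost energy ∝ p but move ⟨V⟩ ∝ √p»; LADDER-CHEM §2 door A / U5; the
pure-state companion of `Literature.Barriers.HubbardSuperconductivity.EnergyWindowCeilingResolution`).
In every finite dimension: for a Hermitian `H`, a subspace `K`, a unit ground eigenvector `ψ ∈ K`
(`Hψ = E₀ψ`), a unit `χ ∈ K` orthogonal to `ψ` with excitation `g = Re⟨χ,Hχ⟩ − E₀ > 0`, a Hermitian `V`
and a window thickness `0 ≤ t ≤ g`, every bracket `lo ≤ Re⟨φ,Vφ⟩ ≤ hi` valid for all unit `φ ∈ K` with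
`Re⟨φ,Hφ⟩ ≤ E₀ + t` has `hi − lo ≥ 4·√((t/g)(1 − t/g))·|⟨ψ,Vχ⟩|`. PROVED
(`energyWindowCoherentAdmixtureFloor_holds`). Door: rows violated by coherent ground–excited admixtures
(stationarity `⟨[H,X]⟩ = 0`), or certificates that are not window functionals (Temple-β door M1, moments
door M4). -/
def EnergyWindowCoherentAdmixtureFloor : Prop :=
  ∀ (n : Type) [Fintype n] (H V : Matrix n n ℂ) (K : Submodule ℂ (n → ℂ)) (E₀ : ℝ)
    (ψ χ : n → ℂ) (t lo hi : ℝ),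
    H.IsHermitian → V.IsHermitian → ψ ∈ K → χ ∈ K → H *ᵥ ψ = (E₀ : ℂ) • ψ →
    star ψ ⬝ᵥ ψ = 1 → star χ ⬝ᵥ χ = 1 → star ψ ⬝ᵥ χ = 0 → 0 ≤ t →
    t ≤ (star χ ⬝ᵥ H *ᵥ χ).re - E₀ → 0 < (star χ ⬝ᵥ H *ᵥ χ).re - E₀ →
    IsWindowBracket H K (E₀ + t) V lo hi →
      4 * Real.sqrt (t / ((star χ ⬝ᵥ H *ᵥ χ).re - E₀) * (1 - t / ((star χ ⬝ᵥ H *ᵥ χ).re - E₀))) *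
        ‖star ψ ⬝ᵥ V *ᵥ χ‖ ≤ hi - lo

/-- **The barrier holds** (by `windowBracket_width_ge`). -/
theorem energyWindowCoherentAdmixtureFloor_holds : EnergyWindowCoherentAdmixtureFloor :=
  fun _n _ _H _V _K _E₀ _ψ _χ _t _lo _hi hH hV hψK hχK hHψ hψ hχ horth ht0 htg hg hW =>
    windowBracket_width_ge hH hV hψK hχK hHψ hψ hχ horth ht0 htg hg hW

end Barriers
end Summit.Ventures.CertifiedQuantumChemistry
end
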